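import Mathlib
import Summits.QuantumAdvantage.QuantumAdvantage.Theorems.LinnikCubicClassGroupsPureCubicClassNumberHardDescentGalois
import HarnessLib

/-!
# Relative norms in a quadratic Galois extension: `N_{L/K}(𝔄)𝓞_L = 𝔄 · τ𝔄`

Route `LinnikCubicClassGroups` (rank-0 hypothesis-type target `PureCubicClassNumberHard`,
stmt-QuantumAdvantage-11826): infrastructure for the Hasse-free DESCENT `3 ∣ h(K(ζ₃)) ⟹ 3 ∣ h(K)`
of Honda's criterion (`…PureCubicClassNumberHardDescent.lean`).

For number fields `K ⊆ L` with `L/K` Galois of degree `2`, `Gal(L/K) = {1, τ}`: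
* `map_relNorm_eq_mul_smul_of_isMaximal` — `N_{L/K}(𝔓)𝓞_L = 𝔓 · τ𝔓` for a prime `𝔓` (the
  fundamental identity `∑ e f = 2` and transitivity of `Gal(L/K)` on the primes over `𝔓 ∩ 𝓞_K`);
* `map_relNorm_eq_mul_smul` — the same for every ideal (multiplicativity of `Ideal.relNorm`);
* `mk0_mul_smul_pow_classNumber` — hence `[𝔄 · τ𝔄]^{h_K} = 1` in `Cl(L)`.

HONEST FRAMING (block-2b rule): kernel-checked classical algebraic number theory (Honda 1971), an
independent certification, NOT summit progress; the crux `PureCubicClassNumberHard` is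
hypothesis-type and untouched.

## References
* T. Honda, *Pure cubic fields whose class numbers are multiples of three*, J. Number Theory 3
  (1971) 7–12, Theorem. [Honda1971]
* S. Aouissi, D. C. Mayer, M. C. Ismaili, M. Talbi, A. Azizi, *3-rank of ambiguous class groups of
  cubic Kummer extensions*, Period. Math. Hungar. 81 (2020), Thm. 2.3. [AouissiMayerIsmailiTalbiAzizi2020]
-/

set_option linter.dupNamespace false

open NumberField

open scoped Pointwise NumberField nonZeroDivisors

namespace Summit.QuantumAdvantage.QuantumAdvantage.Theorems.LinnikCubicClassGroups

variable {K L : Type*} [Field K] [NumberField K] [Field L] [NumberField L] [Algebra K L]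

/-- **`N_{L/K}(𝔓)𝓞_L = 𝔓 · τ𝔓` for a prime `𝔓`** of a quadratic Galois extension `L/K` with
`Gal(L/K) = {1, τ}`: if `τ𝔓 = 𝔓` then `𝔓` is the only prime over `𝔭 = 𝔓 ∩ 𝓞_K` and
`e f = 2`, so `𝔭^f 𝓞_L = 𝔓^{ef} = 𝔓²`; otherwise `𝔭𝓞_L = 𝔓 · τ𝔓` with `e = f = 1`. [folklore] -/
theorem map_relNorm_eq_mul_smul_of_isMaximal [IsGalois K L] (h2 : Module.finrank K L = 2)
    {τ : L ≃ₐ[K] L} (hτ : τ ≠ 1) (P : Ideal (𝓞 L)) [hP : P.IsMaximal] :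
    (Ideal.relNorm (𝓞 K) P).map (algebraMap (𝓞 K) (𝓞 L)) = P * τ • P := by
  classical
  set p := P.under (𝓞 K) with hpdef
  haveI hpmax : p.IsMaximal := Ideal.IsMaximal.under (𝓞 K) P
  haveI : P.LiesOver p := ⟨rfl⟩
  have hP0 : P ≠ ⊥ := Ideal.IsMaximal.ne_bot_of_isIntegral_int P
  have hp0 : p ≠ ⊥ := mt Ideal.eq_bot_of_comap_eq_bot hP0
  have hsum : ∑ Q ∈ (p.primesOver (𝓞 L)).toFinset, Q.ramificationIdx (𝓞 K) * Q.inertiaDeg (𝓞 K)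
      = 2 := by
    rw [← Finset.sum_set_coe, ← h2, ← IsGalois.card_aut_eq_finrank]
    exact Ideal.sum_ramification_inertia_eq_card p (𝓞 L) (G := L ≃ₐ[K] L)
  rw [Ideal.relNorm_eq_pow_of_isMaximal P p, Ideal.map_pow,
    Ideal.map_algebraMap_eq_finsetProd_pow hp0]
  have hmemP : P ∈ (p.primesOver (𝓞 L)).toFinset := by
    rw [Set.mem_toFinset]
    exact ⟨hP.isPrime, ⟨rfl⟩⟩
  haveI : (τ • P).IsPrime := hP.isPrime.smul τ
  have hmemτ : τ • P ∈ (p.primesOver (𝓞 L)).toFinset := by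
    rw [Set.mem_toFinset]
    exact ⟨inferInstance, ⟨by rw [Ideal.under_smul]⟩⟩
  -- every prime over `p` is `P` or `τ • P`
  have hall : ∀ Q ∈ (p.primesOver (𝓞 L)).toFinset, Q = P ∨ Q = τ • P := by
    intro Q hQ
    rw [Set.mem_toFinset] at hQ
    haveI := hQ.1
    haveI := hQ.2
    obtain ⟨g, hg⟩ := Ideal.exists_smul_eq_of_isGaloisGroup p P Q (L ≃ₐ[K] L)
    rcases algEquiv_eq_one_or_eq_of_finrank_eq_two h2 hτ g with rfl | rfl
    · left
      rw [← hg, one_smul]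
    · right
      exact hg.symm
  -- positivity of `e` and `f`
  have hepos : ∀ Q ∈ (p.primesOver (𝓞 L)).toFinset, 0 < Q.ramificationIdx (𝓞 K) := by
    intro Q hQ
    rw [Set.mem_toFinset] at hQ
    haveI := hQ.1
    haveI := hQ.2
    exact Ideal.ramificationIdx_pos Q (𝓞 K)
  have hfpos : ∀ Q ∈ (p.primesOver (𝓞 L)).toFinset, 0 < Q.inertiaDeg (𝓞 K) := by
    intro Q hQ
    rw [Set.mem_toFinset] at hQ
    haveI := hQ.1
    haveI := hQ.2
    exact Ideal.inertiaDeg_pos Q (𝓞 K)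
  by_cases hfix : τ • P = P
  · -- `P` is the only prime over `p`
    have hset : (p.primesOver (𝓞 L)).toFinset = {P} := by
      ext Q
      simp only [Finset.mem_singleton]
      constructor
      · intro hQ
        rcases hall Q hQ with h | h
        · exact h
        · rw [h, hfix]
      · rintro rfl
        exact hmemP
    rw [hset, Finset.sum_singleton] at hsum
    rw [hset, Finset.prod_singleton, hfix, ← pow_mul, hsum, sq]
  · -- `P ≠ τ • P`: both appear, with `e = f = 1`
    have hne : P ≠ τ • P := fun h => hfix h.symm
    have hset : (p.primesOver (𝓞 L)).toFinset = {P, τ • P} := by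
      ext Q
      simp only [Finset.mem_insert, Finset.mem_singleton]
      exact ⟨fun hQ => hall Q hQ, fun h => by rcases h with rfl | rfl <;> assumption⟩
    rw [hset, Finset.sum_pair hne] at hsum
    have heτ : (τ • P).ramificationIdx (𝓞 K) = P.ramificationIdx (𝓞 K) :=
      Ideal.ramificationIdx_smul (𝓞 K) P τ
    have h1 : 1 ≤ P.ramificationIdx (𝓞 K) * P.inertiaDeg (𝓞 K) :=
      Nat.one_le_iff_ne_zero.mpr (Nat.mul_ne_zero (hepos P hmemP).ne' (hfpos P hmemP).ne')
    have h2' : 1 ≤ (τ • P).ramificationIdx (𝓞 K) * (τ • P).inertiaDeg (𝓞 K) :=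
      Nat.one_le_iff_ne_zero.mpr (Nat.mul_ne_zero (hepos _ hmemτ).ne' (hfpos _ hmemτ).ne')
    have hef : P.ramificationIdx (𝓞 K) * P.inertiaDeg (𝓞 K) = 1 := by omega
    have he : P.ramificationIdx (𝓞 K) = 1 := Nat.eq_one_of_mul_eq_one_right hef
    have hf : P.inertiaDeg (𝓞 K) = 1 := Nat.eq_one_of_mul_eq_one_left hef
    rw [hset, Finset.prod_pair hne, heτ, he, hf, pow_one, pow_one, pow_one]

/-- **`N_{L/K}(𝔄)𝓞_L = 𝔄 · τ𝔄`** for every ideal `𝔄` of `𝓞_L`, `L/K` quadratic Galois with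
`Gal(L/K) = {1, τ}` (both sides are multiplicative; primes by
`map_relNorm_eq_mul_smul_of_isMaximal`). [folklore] -/
theorem map_relNorm_eq_mul_smul [IsGalois K L] (h2 : Module.finrank K L = 2)
    {τ : L ≃ₐ[K] L} (hτ : τ ≠ 1) (I : Ideal (𝓞 L)) :
    (Ideal.relNorm (𝓞 K) I).map (algebraMap (𝓞 K) (𝓞 L)) = I * τ • I := by
  classical
  induction I using UniqueFactorizationMonoid.induction_on_prime with
  | h₁ =>
    rw [Ideal.zero_eq_bot, Ideal.relNorm_bot, Ideal.map_bot, Ideal.bot_mul]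
  | h₂ I hI =>
    have hI1 : I = ⊤ := Ideal.isUnit_iff.mp hI
    rw [hI1, Ideal.relNorm_top, Ideal.map_top, Ideal.pointwise_smul_def, Ideal.map_top, Ideal.top_mul]
  | h₃ I P hI hP ih =>
    have hP0 : P ≠ ⊥ := hP.ne_zero
    haveI : P.IsMaximal := (Ideal.isPrime_of_prime hP).isMaximal hP0
    rw [map_mul, Ideal.map_mul, ih, map_relNorm_eq_mul_smul_of_isMaximal h2 hτ P, smul_mul']
    ring

/-- **The norm class kills `[𝔄 · τ𝔄]`**: `[𝔄 · τ𝔄]^{h_K} = 1` in `Cl(L)` (the class of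
`N_{L/K}(𝔄)^{h_K}` is trivial in `Cl(K)`). [folklore] -/
theorem mk0_mul_smul_pow_classNumber [IsGalois K L] (h2 : Module.finrank K L = 2)
    {τ : L ≃ₐ[K] L} (hτ : τ ≠ 1) (I : Ideal (𝓞 L)) (hI : I * τ • I ∈ (Ideal (𝓞 L))⁰) :
    ClassGroup.mk0 ⟨I * τ • I, hI⟩ ^ classNumber K = 1 := by
  classical
  have hI0 : I ≠ ⊥ := by
    intro h
    have := nonZeroDivisors.ne_zero hI
    rw [h, Ideal.bot_mul] at this
    exact this rfl
  set J := Ideal.relNorm (𝓞 K) I with hJ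
  have hJ0 : J ≠ ⊥ := by
    rw [hJ, Ne, Ideal.relNorm_eq_bot_iff]
    exact hI0
  have hJmem : J ∈ (Ideal (𝓞 K))⁰ := mem_nonZeroDivisors_of_ne_zero hJ0
  -- `[J]^{h_K} = 1` in `Cl(K)`, so `J^{h_K} = (g)`
  have hpow_mem : J ^ classNumber K ∈ (Ideal (𝓞 K))⁰ := pow_mem hJmem _
  have hJpow : ClassGroup.mk0 ⟨J ^ classNumber K, hpow_mem⟩ = 1 := by
    have h : (⟨J ^ classNumber K, hpow_mem⟩ : (Ideal (𝓞 K))⁰) = ⟨J, hJmem⟩ ^ classNumber K :=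
      Subtype.ext (by rw [SubmonoidClass.coe_pow])
    rw [h, map_pow, classNumber]
    exact pow_card_eq_one
  obtain ⟨g, hg⟩ := ((ClassGroup.mk0_eq_one_iff hpow_mem).mp hJpow).principal
  -- hence `(I · τI)^{h_K} = (g)𝓞_L`
  have hpow_mem' : (I * τ • I) ^ classNumber K ∈ (Ideal (𝓞 L))⁰ := pow_mem hI _
  have h' : (⟨I * τ • I, hI⟩ : (Ideal (𝓞 L))⁰) ^ classNumber K =
      ⟨(I * τ • I) ^ classNumber K, hpow_mem'⟩ :=
    Subtype.ext (by rw [SubmonoidClass.coe_pow])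
  rw [← map_pow, h', ClassGroup.mk0_eq_one_iff hpow_mem']
  refine ⟨⟨algebraMap (𝓞 K) (𝓞 L) g, ?_⟩⟩
  rw [← map_relNorm_eq_mul_smul h2 hτ I, ← Ideal.map_pow, ← hJ, hg, Ideal.submodule_span_eq,
    Ideal.map_span, Set.image_singleton, Ideal.submodule_span_eq]


end Summit.QuantumAdvantage.QuantumAdvantage.Theorems.LinnikCubicClassGroups
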